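import Summits.CriticalPhenomena.PercolationContinuityZ3.Theorems.PercNearOneGluingNoHeavyQuantLSCoreLMGCellsM
import Summits.CriticalPhenomena.PercolationContinuityZ3.Theorems.PercNearOneGluingNoHeavyQuantLSCoreMMGIneqA
import Mathlib.Tactic.FieldSimp
import Mathlib.Tactic.Ring
import Mathlib.Tactic.Linarith
import Mathlib.Tactic.Positivity
import HarnessLib

/-!
# QUANT lane R8, T-DEC, binder (II) `ConvClosedTResidue`: LS-CORE, pattern LMG — the giant breakpoint `kG` on the cell
# "pre-routing pair light (fits), head pair of low 2 heavy, mid `m+l′` unavailable, `2γ ≤ 1`", region of SMALL `D` (part L: x ≤ 1/2)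

builds on p205010 (kernel theorem, internal audit signed; external expert review pending)

Support file (`--supports stmt-CriticalPhenomena-4575`), QUANT lane seat prim-quant-census-1 (gen 22), rung R8 of
`run/shared/lean/prim/quant/LADDER.md`.  Memo `run/shared/lean/prim/quant/prim-quant-census-1/LSCORE-G22.md` §13.  Theorems only,
standard axioms, no sorries.  Complements part J (large `D`, by hand).

METHOD (the "identity-P" route).  With `c′_P = (1−γ)x − d₁/e₃` the head-cell capacity left by the pre-routed low, `e₂ = 1/A − 1`,
`S_pre = P₂ − c′_P e₂ ≥ 0` the breakpoint premise, `P = γA(1−x) − (1−γ)(A−x)` and `E3C = e₃(1−γ)P − γ²(1−x)(1−A)`, the breakpoint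
slack `F = c′_P e₂ + pool − P₁ − P₂` satisfies the identity `F·((1−γ)A·e₃ − γ(1−A)) = E3C + γ(1−A)·S_pre` (both `F` and `S_pre` are
affine in the tail weight `λ`; eliminate it).  The bracket is positive (`e₃ > (1−x)/x`, `2γ ≤ 1`, `A ≥ x`), so `F ≥ 0` follows from
`E3C ≥ 0`.  `E3C` is free of `λ`; its only `t`-dependence is through `e₃`, which is decreasing in `t`
(`(1+t−w)·G₃(τ) − (1+τ−w)·G₃(t) = (1−x)(τ−t)(2−A)`), and on the region `D ≤ x·min(x, 1/2)` one has `t ≤ τ(x, r)` explicitly; the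
resulting four-variable inequality `E3C|_(t=τ) ≥ 0` is the polynomial certificate `lcell_L1P4b` (`x ≤ 1/2`, `τ = x(2x−r)/(2−x)`) /
`lcell_L1P4c` (`x ≥ 1/2`, `τ = x(1+2(x−r))/(2(2−x))`) of parts M / N.  [this work].
The gluing rows served [cite: KozmaNitzan2024, Conjecture 3 (p. 15)]; product measure [cite: Grimmett1999, §1.3 p. 10].
-/

namespace Summit.CriticalPhenomena.PercolationContinuityZ3.Theorems

namespace Quant

namespace LawDec

namespace LSCoreLMG

set_option maxHeartbeats 8000000 in
set_option maxRecDepth 20000 in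
/-- **`kG`, pattern LMG, cell `3PL fit / 22 unavailable / 2P heavy`, sub-region `2γ ≤ 1`, `x ≤ 1/2`, `D ≤ x²`**: here `t ≤ τ := x(x+(x−r))/(2−x)`,
the efficiency `e₃` of the (light) pre-routing pair is decreasing in `t`, and the breakpoint follows from the premise through the identity
`F·((1−γ)A·e₃ − γ(1−A)) = E3C + γ(1−A)·S_pre` with `E3C = e₃(1−γ)P − γ²(1−x)(1−A)`, `P = γA(1−x) − (1−γ)(A−x)`, and `E3C ≥ E3C|_(t=τ) ≥ 0`
(the last by the polynomial certificate `lcell_L1P4b`). [this work] -/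
theorem kG_3PLf_N_H_regionPb (x r t d w : ℝ) (hx0 : 0 < x) (hx1 : x < 1) (hr0 : 0 ≤ r) (hrx : r < x) (ht : 0 < t)
    (hw0 : 0 < w) (hw1 : w ≤ 1) (hd0 : 0 ≤ d) (hdx : d < x * w) (hre : 0 < r - x + t * (2 - x)) (hre1 : 0 < 1 - t - r)
    (hM1 : 2 * w < r + d + 2 * t) (hM2 : r + d ≤ 2 * w)
    (h22n : w ≤ r + d) (h2H : x ≤ r + d) (h2b : r + d < 1) (hk3 : r + d + 2 * t - 2 * w < x * (1 + t - w))
    (hQ : 2 * (x ^ 2 + (1 - x) * d / w) ≤ 1) (hxl : 2 * x ≤ 1) (hD2 : t * (2 - x ^ 2 - (1 - x) * r) - x * (x - r) ≤ x ^ 2)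
    (hpre : (((1 - (x ^ 2 + (1 - x) * d / w)) * x) - ((x ^ 2 + (1 - x) * d / w) * (1 - x) * ((x - r) * (1 - t - r) / (t * (2 - x ^ 2 - (1 - x) * r) - x * (x - r)))) / (((1 + t - w) - ((1 - x) * (r + d + 2 * t - 2 * w) + x ^ 2 * (1 + t - w))) / ((1 - x) * (r + d + 2 * t - 2 * w) + x ^ 2 * (1 + t - w)))) * (1 / (r + d) - 1) ≤ ((1 - (x ^ 2 + (1 - x) * d / w)) * (1 - x) * ((1 + x - r) * (r - x + t * (2 - x)) / (t * (2 - x ^ 2 - (1 - x) * r) - x * (x - r))))) :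
    ((1 - (x ^ 2 + (1 - x) * d / w)) * (1 - x) * ((x - r) * (1 - t - r) / (t * (2 - x ^ 2 - (1 - x) * r) - x * (x - r)))) + ((1 - (x ^ 2 + (1 - x) * d / w)) * (1 - x) * ((1 + x - r) * (r - x + t * (2 - x)) / (t * (2 - x ^ 2 - (1 - x) * r) - x * (x - r)))) ≤ (((1 - (x ^ 2 + (1 - x) * d / w)) * x) - ((x ^ 2 + (1 - x) * d / w) * (1 - x) * ((x - r) * (1 - t - r) / (t * (2 - x ^ 2 - (1 - x) * r) - x * (x - r)))) / (((1 + t - w) - ((1 - x) * (r + d + 2 * t - 2 * w) + x ^ 2 * (1 + t - w))) / ((1 - x) * (r + d + 2 * t - 2 * w) + x ^ 2 * (1 + t - w)))) * (1 / (r + d) - 1) + ((x ^ 2 + (1 - x) * d / w) * (1 - x)) := by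
  have hD : 0 < (t * (2 - x ^ 2 - (1 - x) * r) - x * (x - r)) := LSCoreMMG.D_pos x r t hx0 hx1 hr0 hrx hre
  set Dv : ℝ := (t * (2 - x ^ 2 - (1 - x) * r) - x * (x - r)) with hDv
  set gg : ℝ := (x ^ 2 + (1 - x) * d / w) with hgg
  set Lm : ℝ := (x - r) * (1 - t - r) / Dv with hLm
  set Lp : ℝ := (1 + x - r) * (r - x + t * (2 - x)) / Dv with hLp
  set G3 : ℝ := (1 - x) * (r + d + 2 * t - 2 * w) + x ^ 2 * (1 + t - w) with hG3
  set ee : ℝ := ((1 + t - w) - G3) / G3 with hee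
  set Av : ℝ := r + d with hAv
  -- signs
  have hA0 : 0 < Av := by rw [hAv]; linarith
  have hA1 : 0 < 1 - Av := by rw [hAv]; linarith
  have hAne : Av ≠ 0 := hA0.ne'
  have hxw : x * w ≤ x * Av := by rw [hAv]; nlinarith
  have hdA : d ≤ x * Av := by linarith
  have hg0 : 0 ≤ gg := by rw [hgg]; positivity
  have hg2 : gg ≤ 1 / 2 := by linarith
  have hsum : Lm + Lp = 1 := by rw [hLm, hLp, ← add_div, div_eq_one_iff_eq hD.ne']; ring
  have hLm0 : 0 ≤ Lm := by rw [hLm]; exact div_nonneg (mul_nonneg (by linarith) (by linarith)) hD.le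
  have hB3 : 0 < r + d + 2 * t - 2 * w := by linarith
  have hG3pos : 0 < G3 := by
    rw [hG3]; exact add_pos_of_pos_of_nonneg (mul_pos (by linarith) hB3) (mul_nonneg (sq_nonneg x) (by linarith))
  have hEX : 0 < (1 - x) / x := div_pos (by linarith) hx0
  have he3s : (1 - x) / x < ee := by
    rw [hee, div_lt_div_iff₀ hx0 hG3pos]; nlinarith [mul_pos hx0 (sub_pos.2 hx1), mul_pos (sub_pos.2 hx1) (sub_pos.2 hk3)]
  have he3pos : 0 < ee := lt_trans hEX he3s
  have heene : ee ≠ 0 := he3pos.ne'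
  -- (2) t ≤ τ
  set τ : ℝ := x * (x + (x - r)) / (2 - x) with hτ
  have h2x : 0 < 2 - x := by linarith
  have ht_le : t ≤ τ := by
    rw [hτ, le_div_iff₀ h2x]
    have hc : t * (2 - x) ≤ t * (2 - x ^ 2 - (1 - x) * r) := mul_le_mul_of_nonneg_left (by nlinarith) ht.le
    nlinarith
  -- (3) monotonicity of e₃ in t
  set G3τ : ℝ := (1 - x) * (Av + 2 * τ - 2 * w) + x ^ 2 * (1 + τ - w) with hG3τ
  have hB3τ : 0 < Av + 2 * τ - 2 * w := by rw [hAv]; linarith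
  have hG3τpos : 0 < G3τ := by
    rw [hG3τ]; exact add_pos_of_pos_of_nonneg (mul_pos (by linarith) hB3τ) (mul_nonneg (sq_nonneg x) (by linarith))
  set eeτ : ℝ := ((1 + τ - w) - G3τ) / G3τ with heeτ
  have hmono_id : (1 + t - w) * G3τ - (1 + τ - w) * G3 = (1 - x) * (τ - t) * (2 - Av) := by
    rw [hG3τ, hG3, hAv]; ring
  have hmono : eeτ ≤ ee := by
    have h1 : (1 + τ - w) / G3τ ≤ (1 + t - w) / G3 := by
      rw [div_le_div_iff₀ hG3τpos hG3pos]
      nlinarith [mul_nonneg (mul_nonneg (show (0:ℝ) ≤ 1 - x by linarith) (show (0:ℝ) ≤ τ - t by linarith)) hA1.le]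
    have e1 : eeτ = (1 + τ - w) / G3τ - 1 := by rw [heeτ]; field_simp
    have e2 : ee = (1 + t - w) / G3 - 1 := by rw [hee]; field_simp
    rw [e1, e2]; linarith
  -- (4) the certificate at t = τ
  have hcell := lcell_L1P4b x r d w hx0.le (by linarith) hr0 hw0.le (by linarith) hd0 (by linarith)
    (by linarith [hAv]) (by linarith [hAv]) (by linarith [hAv]) (by linarith [hAv])
    (by have : (2:ℝ) * gg * w ≤ w := by nlinarith
        rw [hgg] at this; have hw' : w ≠ 0 := hw0.ne'
        have e : 2 * (x ^ 2 + (1 - x) * d / w) * w = 2 * x ^ 2 * w + 2 * (1 - x) * d := by field_simp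
        nlinarith [e])
    (by have := ht_le; rw [hτ, le_div_iff₀ h2x] at this; nlinarith) (by linarith)
  set P : ℝ := gg * Av * (1 - x) - (1 - gg) * (Av - x) with hP
  have hid : (eeτ * (1 - gg) * P - gg ^ 2 * (1 - x) * (1 - Av)) * (G3τ * w ^ 2 * (2 - x))
      = -2 * x ^ 8 * d * w ^ 3 - 2 * x ^ 8 * r * w ^ 3 + 2 * x ^ 8 * r * d * w ^ 2 + 2 * x ^ 8 * r ^ 2 * w ^ 2 - 4 * x ^ 9 * d * w ^ 2 - 4 * x ^ 9 * r * w ^ 2 + 11 * x ^ 7 * d * w ^ 3 + 2 * x ^ 7 * d ^ 2 * w ^ 2 + 11 * x ^ 7 * r * w ^ 3 - 7 * x ^ 7 * r * d * w ^ 2 - 4 * x ^ 7 * r * d ^ 2 * w - 9 * x ^ 7 * r ^ 2 * w ^ 2 - 4 * x ^ 7 * r ^ 2 * d * w + 16 * x ^ 8 * d * w ^ 2 + 8 * x ^ 8 * d ^ 2 * w + 16 * x ^ 8 * r * w ^ 2 + 8 * x ^ 8 * r * d * w - 22 * x ^ 6 * d * w ^ 3 - 17 * x ^ 6 * d ^ 2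 * w ^ 2 + 2 * x ^ 6 * d ^ 3 * w - 22 * x ^ 6 * r * w ^ 3 + 24 * x ^ 6 * r * d ^ 2 * w + 2 * x ^ 6 * r * d ^ 3 + 17 * x ^ 6 * r ^ 2 * w ^ 2 + 22 * x ^ 6 * r ^ 2 * d * w + 2 * x ^ 6 * r ^ 2 * d ^ 2 - x ^ 7 * w ^ 3 - 23 * x ^ 7 * d * w ^ 2 - 40 * x ^ 7 * d ^ 2 * w - 4 * x ^ 7 * d ^ 3 - 22 * x ^ 7 * r * w ^ 2 - 40 * x ^ 7 * r * d * w - 4 * x ^ 7 * r * d ^ 2 - 2 * x ^ 8 * w ^ 2 + 15 * x ^ 5 * d * w ^ 3 + 55 * x ^ 5 * d ^ 2 * w ^ 2 - 7 * x ^ 5 * d ^ 3 * w - 2 * x ^ 5 * d ^ 4 + 15 * x ^ 5 * r * w ^ 3 + 44 * x ^ 5 * r * d * w ^ 2 - 60 * x ^ 5 * r * d ^ 2 * w - 15 * x ^ 5 * r * d ^ 3 - 11 * x ^ 5 * r ^ 2 * w ^ 2 - 53 * x ^ 5 * r ^ 2 * d * w - 13 * x ^ 5 * r ^ 2 * d ^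 2 + 7 * x ^ 6 * w ^ 3 + 3 * x ^ 6 * d * w ^ 2 + 80 * x ^ 6 * d ^ 2 * w + 24 * x ^ 6 * d ^ 3 - 4 * x ^ 6 * r * w ^ 2 + 78 * x ^ 6 * r * d * w + 24 * x ^ 6 * r * d ^ 2 + 11 * x ^ 7 * w ^ 2 + 4 * x ^ 7 * d * w + 9 * x ^ 4 * d * w ^ 3 - 82 * x ^ 4 * d ^ 2 * w ^ 2 - 4 * x ^ 4 * d ^ 3 * w + 13 * x ^ 4 * d ^ 4 + 9 * x ^ 4 * r * w ^ 3 - 89 * x ^ 4 * r * d * w ^ 2 + 59 * x ^ 4 * r * d ^ 2 * w + 51 * x ^ 4 * r * d ^ 3 - 7 * x ^ 4 * r ^ 2 * w ^ 2 + 63 * x ^ 4 * r ^ 2 * d * w + 38 * x ^ 4 * r ^ 2 * d ^ 2 - 16 * x ^ 5 * w ^ 3 + 14 * x ^ 5 * d * w ^ 2 - 62 * x ^ 5 * d ^ 2 * w - 61 * x ^ 5 * d ^ 3 + 34 * x ^ 5 * r * w ^ 2 - 51 * x ^ 5 * r * d * w - 60 * x ^ 5 * r * d ^ 2 - 17 *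 x ^ 6 * w ^ 2 - 22 * x ^ 6 * d * w - 2 * x ^ 6 * d ^ 2 - 16 * x ^ 3 * d * w ^ 3 + 47 * x ^ 3 * d ^ 2 * w ^ 2 + 48 * x ^ 3 * d ^ 3 * w - 33 * x ^ 3 * d ^ 4 - 16 * x ^ 3 * r * w ^ 3 + 60 * x ^ 3 * r * d * w ^ 2 + 21 * x ^ 3 * r * d ^ 2 * w - 95 * x ^ 3 * r * d ^ 3 + 13 * x ^ 3 * r ^ 2 * w ^ 2 - 27 * x ^ 3 * r ^ 2 * d * w - 62 * x ^ 3 * r ^ 2 * d ^ 2 + 13 * x ^ 4 * w ^ 3 + 15 * x ^ 4 * d * w ^ 2 - 15 * x ^ 4 * d ^ 2 * w + 78 * x ^ 4 * d ^ 3 - 22 * x ^ 4 * r * w ^ 2 - 38 * x ^ 4 * r * d * w + 73 * x ^ 4 * r * d ^ 2 + 8 * x ^ 5 * w ^ 2 + 42 * x ^ 5 * d * w + 11 * x ^ 5 * d ^ 2 + 2 * x ^ 2 * d * w ^ 3 + 13 * x ^ 2 * d ^ 2 * w ^ 2 - 80 * x ^ 2 * d ^ 3 * w + 41 * x ^ 2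 * d ^ 4 + 2 * x ^ 2 * r * w ^ 3 + 10 * x ^ 2 * r * d * w ^ 2 - 95 * x ^ 2 * r * d ^ 2 * w + 99 * x ^ 2 * r * d ^ 3 - 3 * x ^ 2 * r ^ 2 * w ^ 2 - 15 * x ^ 2 * r ^ 2 * d * w + 58 * x ^ 2 * r ^ 2 * d ^ 2 - 49 * x ^ 3 * d * w ^ 2 + 45 * x ^ 3 * d ^ 2 * w - 42 * x ^ 3 * d ^ 3 - 9 * x ^ 3 * r * w ^ 2 + 74 * x ^ 3 * r * d * w - 33 * x ^ 3 * r * d ^ 2 + 7 * x ^ 4 * w ^ 2 - 36 * x ^ 4 * d * w - 23 * x ^ 4 * d ^ 2 + 5 * x * d * w ^ 3 - 26 * x * d ^ 2 * w ^ 2 + 55 * x * d ^ 3 * w - 25 * x * d ^ 4 + 5 * x * r * w ^ 3 - 30 * x * r * d * w ^ 2 + 75 * x * r * d ^ 2 * w - 54 * x * r * d ^ 3 - 4 * x * r ^ 2 * w ^ 2 + 20 * x * r ^ 2 * d * w - 29 * x * r ^ 2 * d ^ 2 - 5 * x ^ 2 * w ^ 3 + 35 * x ^ 2 * d * w ^ 2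 - 3 * x ^ 2 * d ^ 2 * w - 8 * x ^ 2 * d ^ 3 + 14 * x ^ 2 * r * w ^ 2 - 30 * x ^ 2 * r * d * w - 15 * x ^ 2 * r * d ^ 2 - 8 * x ^ 3 * w ^ 2 + 10 * x ^ 3 * d * w + 23 * x ^ 3 * d ^ 2 - 2 * d * w ^ 3 + 8 * d ^ 2 * w ^ 2 - 14 * d ^ 3 * w + 6 * d ^ 4 - 2 * r * w ^ 3 + 10 * r * d * w ^ 2 - 20 * r * d ^ 2 * w + 12 * r * d ^ 3 + 2 * r ^ 2 * w ^ 2 - 6 * r ^ 2 * d * w + 6 * r ^ 2 * d ^ 2 + 2 * x * w ^ 3 - 5 * x * d * w ^ 2 - 23 * x * d ^ 2 * w + 19 * x * d ^ 3 - x * r * w ^ 2 - 7 * x * r * d * w + 21 * x * r * d ^ 2 - x ^ 2 * w ^ 2 + 6 * x ^ 2 * d * w - 11 * x ^ 2 * d ^ 2 - 2 * d * w ^ 2 + 10 * d ^ 2 * w - 6 * d ^ 3 - 2 * r * w ^ 2 + 6 * r * d * w - 6 * r * d ^ 2 + 2 * x * w ^ 2 - 4 * x * d * w + 2 * x * d ^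 2 := by
    have hw' : w ≠ 0 := hw0.ne'
    have hG3τne : G3τ ≠ 0 := hG3τpos.ne'
    have h2xne : (2:ℝ) - x ≠ 0 := h2x.ne'
    rw [heeτ, hP, hgg, hAv]
    field_simp
    rw [hG3τ, hτ, hAv]
    field_simp
    ring
  have hE3Cτ : 0 ≤ eeτ * (1 - gg) * P - gg ^ 2 * (1 - x) * (1 - Av) := by
    have hm : 0 < G3τ * w ^ 2 * (2 - x) := by positivity
    exact (mul_nonneg_iff_of_pos_right hm).1 (by rw [hid]; exact hcell)
  clear hid hcell
  -- (5) P ≥ 0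
  have hgA : x ^ 2 + (1 - x) * d / Av ≤ gg := by
    rw [hgg]
    have h1 : d / Av ≤ d / w := div_le_div_of_nonneg_left hd0 hw0 (by rw [hAv]; exact h22n)
    have h2 : (1 - x) * d / Av ≤ (1 - x) * d / w := by
      rw [mul_div_assoc, mul_div_assoc]; exact mul_le_mul_of_nonneg_left h1 (by linarith)
    linarith
  have hPpos : 0 ≤ P := by
    have hr : x - r = x - Av + d := by rw [hAv]; ring
    have key : ((x ^ 2 + (1 - x) * d / Av) * Av * (1 - x) - (1 - (x ^ 2 + (1 - x) * d / Av)) * (Av - x)) * Av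
        = (1 - x) * ((x * Av - d) ^ 2 + (x - Av + d) * (Av * (1 + x) - d)) := by
      field_simp; ring
    have hsq : 0 ≤ (x * Av - d) ^ 2 := sq_nonneg _
    have hs0 : 0 ≤ x - Av + d := by linarith
    have hl : 0 ≤ (x - Av + d) * (Av * (1 + x) - d) := mul_nonneg hs0 (by nlinarith)
    have h2 : 0 ≤ ((x ^ 2 + (1 - x) * d / Av) * Av * (1 - x) - (1 - (x ^ 2 + (1 - x) * d / Av)) * (Av - x)) * Av := by
      rw [key]; exact mul_nonneg (by linarith) (by linarith)
    have h3 := (mul_nonneg_iff_of_pos_right hA0).1 h2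
    have h4 : 0 ≤ Av * (1 - x) + (Av - x) := by rw [hAv]; nlinarith
    rw [hP]; nlinarith [mul_le_mul_of_nonneg_right hgA h4]
  -- (6) E3C at t ≥ E3C at τ ≥ 0
  have hE3C : 0 ≤ ee * (1 - gg) * P - gg ^ 2 * (1 - x) * (1 - Av) := by
    have : eeτ * ((1 - gg) * P) ≤ ee * ((1 - gg) * P) := mul_le_mul_of_nonneg_right hmono (mul_nonneg (by linarith) hPpos)
    nlinarith
  -- (7)–(10) identity-P and conclusion
  have hLp' : Lp = 1 - Lm := by linarith
  rw [hLp'] at hpre ⊢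
  have hden : 0 < (1 - gg) * Av * ee - gg * (1 - Av) := by
    have h1 : (1 - x) / 2 < (1 - gg) * Av * ee := by
      have a : x / 2 ≤ (1 - gg) * Av := by nlinarith
      have b : (x / 2) * ((1 - x) / x) ≤ ((1 - gg) * Av) * ((1 - x) / x) := mul_le_mul_of_nonneg_right a hEX.le
      have c : ((1 - gg) * Av) * ((1 - x) / x) < (1 - gg) * Av * ee := mul_lt_mul_of_pos_left he3s (by nlinarith)
      have e : (x / 2) * ((1 - x) / x) = (1 - x) / 2 := by field_simp
      linarith
    nlinarith
  have key : (((1 - gg) * x - gg * (1 - x) * Lm / ee) * (1 / Av - 1) + gg * (1 - x) - (1 - gg) * (1 - x)) * ((1 - gg) * Av * ee - gg * (1 - Av))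
      = (ee * (1 - gg) * P - gg ^ 2 * (1 - x) * (1 - Av))
        + gg * (1 - Av) * ((1 - gg) * (1 - x) * (1 - Lm) - ((1 - gg) * x - gg * (1 - x) * Lm / ee) * (1 / Av - 1)) := by
    rw [hP]; field_simp; ring
  have hS : 0 ≤ (1 - gg) * (1 - x) * (1 - Lm) - ((1 - gg) * x - gg * (1 - x) * Lm / ee) * (1 / Av - 1) := by linarith
  have hF : 0 ≤ ((1 - gg) * x - gg * (1 - x) * Lm / ee) * (1 / Av - 1) + gg * (1 - x) - (1 - gg) * (1 - x) :=
    (mul_nonneg_iff_of_pos_right hden).1 (by rw [key]; exact add_nonneg hE3C (mul_nonneg (mul_nonneg hg0 hA1.le) hS))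
  nlinarith [hF]

end LSCoreLMG

end LawDec

end Quant

end Summit.CriticalPhenomena.PercolationContinuityZ3.Theorems
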